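import Summits.BirchSwinnertonDyer.BirchSwinnertonDyer.Theorems.PrintCf2SplitBadTwoKummerUClassLevelTwistedRamified
import HarnessLib

/-!
# Crux `PrintCf2.SplitBadTwoRankOneOfFacts` (stmt-BirchSwinnertonDyer-20368), skeleton v13.5, registered stub `stub_xRegular_two` = (REG₂) and
# M-LINE-PIN stub (R) (24086), FACT-FREE road: the class-level twisted (PRO-NULL)_U WITH SLACK AT `v̄` — the `v̄`-divisibility asked only
# modulo `p^d` for a slack `d` fixed in advance (the class runs `d` levels higher), so that a NORM-TRICK reading at an INERT `v̄` (residue degree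
# `p^d`, the `v`-LINE layers `K^{(v)}_n`) feeds it

Cell `bsd-print-cf2`, EXTRA WIDTH seat `bsd-line-cf2-p1-w4` g14 (prover-bsd-line-cf2-p1-w4-g14-0); `--supports stmt-BirchSwinnertonDyer-20368`
(helper, Theses-free). HONEST FRAMING: nothing here closes the crux or a registered stub; BSD is not proved by any of this; no summit
statement is proved by this seat. No definition, no named fact, no `sorry`. UNCONDITIONAL.

WHY. B5-U by the norm trick (-w3 g14, `NormAtVbar.dvd_log_valuation_norm_of_dualShapiro_mem`) reads the dual condition at `v̄` on
`N_{F/K} b` in `K_v̄`: `p^M ∣ ord_v̄(N b) = f · ord_w̃(b)` with `f` the residue degree of the (unique, on the frame) place `w̃ ∣ v̄` of `F`. On the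
`v̄`-line (`κ₂`, `v̄` totally ramified) `f = 1`; on the `v`-LINE (`κ₁`, M-LINE-PIN stub (R): `v̄` INERT in `K^{(v)}_n` on DA7 frames) `f = p^n`, so only
`p^{M−n} ∣ ord_w̃(b)` comes out. THIS FILE absorbs any such fixed loss: **`exists_level_resH1Hom_eq_zero_of_local_twisted_slack (d : ℕ)`** =
p705557 `…_twisted_ramified` VERBATIM except that the returned class level satisfies `d ≤ M` and the `v̄` hypothesis asks only
`p^{M−d} ∣ ord_{w′}(b′)` (or the non-split escape). Proof = p705557's with class level `M = M₀ + 1 + d` (`M₀` = R1's level for `k + e`):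
unramified places give `p^M ∣ ord`, ramified/non-split places `p^{M−1} ∣ ord`, `v̄`-places `p^{M−d} ∣ ord`, local powers at `v` descend by
`y ↦ y^{p^{1+d}}` — all `≥ p^{M₀}`. It also covers `θ = 1` (`ε = 1`, `F′ = F`) and `d = 0` (= p705557 up to the level shift).
presearch: as p705557; no new fact. beyond-print theorem: no.

References: [deShalit1987] III.2.3; [SerreLocalFields1979] X §3 b); [NeukirchSchmidtWingberg2008] (1.6.6)–(1.6.7); [NeukirchANT1999] Ch. I §9.
-/

noncomputable section

set_option linter.dupNamespace false
set_option autoImplicit false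

open scoped Classical Pointwise
open NumberField IsDedekindDomain Field IntermediateField
open Literature.NumberTheory.EllipticCurves Literature.NumberTheory.EllipticCurves.GreenbergSelmer
open Literature.NumberTheory.EllipticCurves.GreenbergVatsal2000
open Literature.NumberTheory.GaloisRepresentations Literature.NumberTheory.GaloisRepresentations.LocalWeilDatum
open Summit.BirchSwinnertonDyer.BirchSwinnertonDyer.Theorems.PrintCf2.KummerU
open Summit.BirchSwinnertonDyer.BirchSwinnertonDyer.Theorems.PrintCf2.UpperBaseLift

namespace Summit.BirchSwinnertonDyer.BirchSwinnertonDyer.Theorems.PrintCf2.KummerUDict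

variable {K : Type} [Field K] [NumberField K]

/-! ## The class-level twisted (PRO-NULL)_U with ramification and slack at `v̄` -/

variable {p : ℕ} [Fact p.Prime]

/-- **CLASS-LEVEL (PRO-NULL)_U FOR TWISTED COEFFICIENTS, RAMIFICATION ALLOWED, SLACK `c` AT `v̄`.** See the module docstring: p705557 with
the returned level `M ≥ d` and the `v̄` divisibility asked only as `p^{M−d} ∣ ord_{w′}(b′)` (or the non-split escape). `F ⊆ F′ ⊆ K̄`,
`U = Gal(K̄/F)`, `Gal(K̄/F′) = {u ∈ U : ε u = 1}`, `F′/K` finite abelian, `K` imaginary quadratic, `p = v v̄`.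
[cite: deShalit1987, III.2.3 (Theorem (Baker–Brumer))] [cite: SerreLocalFields1979, X §3 b)] [cite: NeukirchSchmidtWingberg2008, (1.6.6)–(1.6.7)] -/
theorem exists_level_resH1Hom_eq_zero_of_local_twisted_slack (d : ℕ) (hK : IsImaginaryQuadratic K) {v vbar : HeightOneSpectrum (𝓞 K)}
    (hv : ((p : ℕ) : 𝓞 K) ∈ v.asIdeal) (hvbar : ((p : ℕ) : 𝓞 K) ∈ vbar.asIdeal) (hne : vbar ≠ v)
    (F F' : IntermediateField K (AlgebraicClosure K)) [FiniteDimensional K F'] [IsAbelianGalois K F'] [NumberField F']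
    [(galFixing K F).Normal] [(galFixing K F').Normal] (ε : absoluteGaloisGroup K →* ℤˣ)
    (hU' : galFixing K F' ≤ galFixing K F) (hεU' : ∀ u ∈ galFixing K F', ε u = 1)
    (hker : ∀ u ∈ galFixing K F, ε u = 1 → u ∈ galFixing K F') (k : ℕ) :
    ∃ M : ℕ, k ≤ M ∧ d ≤ M ∧
      ∀ {X : Type} [AddCommGroup X] [DistribMulAction (absoluteGaloisGroup K) X] [TopologicalSpace X] [DiscreteTopology X]
        {X₀ : Type} [AddCommGroup X₀] [DistribMulAction (absoluteGaloisGroup K) X₀] [TopologicalSpace X₀] [DiscreteTopology X₀]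
        (ι : X →+ Additive (AlgebraicClosure K)ˣ) (_ : Function.Injective ι)
        (_ : ∀ (g : absoluteGaloisGroup K) (x : X), Additive.toMul (ι (g • x)) = (g • Additive.toMul (ι x)) ^ ((ε g : ℤˣ) : ℤ))
        (_ : ∀ x : X, p ^ M • x = 0)
        (ι₀ : X₀ →+ Additive (AlgebraicClosure K)ˣ) (_ : Function.Injective ι₀)
        (_ : ∀ (g : absoluteGaloisGroup K) (x : X₀), Additive.toMul (ι₀ (g • x)) = (g • Additive.toMul (ι₀ x)) ^ ((ε g : ℤˣ) : ℤ))
        (_ : ∀ m : (AlgebraicClosure K)ˣ, m ^ p ^ k = 1 → ∃ a₀ : X₀, Additive.toMul (ι₀ a₀) = m)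
        (t : X →+ X₀) (ht : ∀ (g : absoluteGaloisGroup K) (x : X), t (g • x) = g • t x)
        (_ : ∀ x : X, Additive.toMul (ι₀ (t x)) = Additive.toMul (ι x) ^ p ^ (M - k))
        (φ : contOneCocycles (discreteTopRep (galFixing K F) X)),
        (∀ σ : absoluteGaloisGroup K, conjH1 (galFixing K F) X σ (oneCocycleClass _ φ) ∈ awayKer (galFixing K F) X v) →
        (∀ w : HeightOneSpectrum (𝓞 K), w ≠ v → w ≠ vbar →
          (∀ σ : absoluteGaloisGroup K, conjH1 (galFixing K F) X σ (oneCocycleClass _ φ) ∈ unramifiedKer (galFixing K F) X w) ∨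
          (GreenbergSelmer.inertia w ≤ galFixing K F ∧ ∃ τ ∈ GreenbergSelmer.inertia w, ε τ ≠ 1)) →
        (∀ β : (AlgebraicClosure K)ˣ,
          (∀ u : galFixing K F', Additive.toMul (ι (φ.1 ⟨u, hU' u.2⟩)) = (u : absoluteGaloisGroup K) • β / β) →
          ∀ b : F', ((b : F') : AlgebraicClosure K) = ((β ^ p ^ M : (AlgebraicClosure K)ˣ) : AlgebraicClosure K) →
          ∀ w' : vbar.Extension (𝓞 F'),
            ((p ^ (M - d) : ℕ) : ℤ) ∣ WithZero.log (w'.1.valuation F' b) ∨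
            ∃ 𝔓 : Ideal (absIntegers (𝓞 K) K),
              𝔓.comap (ringOfIntegersToIntegralClosure (k := K) (Ω := AlgebraicClosure K) F') = w'.1.asIdeal ∧
              ∃ s ∈ galFixing K F, ε s ≠ 1 ∧ s • 𝔓 = 𝔓) →
        resH1Hom (ContinuousMonoidHom.id (galFixing K F)) t (fun g x ↦ ht g x) (oneCocycleClass _ φ) = 0 := by
  have hp : p.Prime := Fact.out
  -- the shift `e` for `F′`, R1's level `M₀ = M_{F′}(k + e)` and the class level `M = M₀ + 1`
  obtain ⟨e, he⟩ := exists_pow_prime_pow_eq_one_of_forall_galFixing_smul_eq (K := K) F' hp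
  obtain ⟨M₀, hkeM₀, hM₀⟩ := KummerProNull.exists_level_forall_exists_pow_eq_of_local (p := p) hK hv hvbar hne F' (k + e)
  have hM₀M : M₀ ≤ M₀ + 1 + d := (Nat.le_succ M₀).trans (Nat.le_add_right _ d)
  refine ⟨M₀ + 1 + d, le_trans (Nat.le_add_right k e) (hkeM₀.trans hM₀M), Nat.le_add_left d _, ?_⟩
  intro X _ _ _ _ X₀ _ _ _ _ ι hιinj hι hX ι₀ hι₀inj hι₀ hι₀surj t ht htι φ hloc hunr hbar
  set M := M₀ + 1 + d with hMdef
  -- §1: the attached twisted cocycle `c : Γ_K → K̄ˣ` on `U`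
  obtain ⟨c, hc, hcc, hcM⟩ := exists_twistedCocycle_of_oneCocycle (galFixing K F) ε ι hι φ hX
  -- Kummer over `U′ = Gal(K̄/F′)` (untwisted there): `c = ∂β` on `U′`, `β^{p^M} = b′ ∈ F′`
  have hcoc : ∀ g h : galFixing K F', (fun g : galFixing K F' ↦ c g) (g * h) =
      (fun g : galFixing K F' ↦ c g) g * (g : absoluteGaloisGroup K) • (fun g : galFixing K F' ↦ c g) h := by
    intro g h
    simp only [Subgroup.coe_mul]
    rw [hcc g (hU' g.2) h (hU' h.2), hεU' g g.2, Units.val_one, zpow_one]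
  have hopen : IsOpen {g : galFixing K F' | (fun g : galFixing K F' ↦ c g) g = 1} := by
    have h0 : {g : galFixing K F' | (fun g : galFixing K F' ↦ c g) g = 1} =
        (fun g : galFixing K F' ↦ φ.1 ⟨g, hU' g.2⟩) ⁻¹' {0} := by
      ext g
      simp only [Set.mem_setOf_eq, Set.mem_preimage, Set.mem_singleton_iff, hc g (hU' g.2)]
      constructor
      · intro h
        apply hιinj
        rw [map_zero]
        exact Additive.toMul.injective (by rw [h, toMul_zero])
      · intro h
        rw [h, map_zero, toMul_zero]
    rw [h0]
    exact (isOpen_discrete _).preimage (φ.1.continuous.comp (continuous_inclusion hU'))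
  have hn : ∀ g : galFixing K F', (fun g : galFixing K F' ↦ c g) g ^ p ^ M = 1 := fun g ↦ hcM g (hU' g.2)
  obtain ⟨β, b, hb, hcβ⟩ := galFixing.exists_kummer_of_cocycle_charZero F' (p ^ M) _ hcoc hopen hn
  have hres : ∀ u ∈ galFixing K F', c u = u • β / β := fun u hu ↦ hcβ ⟨u, hu⟩
  have hres' : ∀ u ∈ galFixing K F', ((c u : (AlgebraicClosure K)ˣ) : AlgebraicClosure K) =
      u • (β : AlgebraicClosure K) / β := fun u hu ↦ by
    rw [hres u hu, Units.val_div_eq_div_val, Units.coe_smul]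
  have hβM : ((β : AlgebraicClosure K)) ^ p ^ M = ((b : F') : AlgebraicClosure K) := hb.symm
  have hb0 : b ≠ 0 := by
    intro h0
    rw [h0] at hb
    exact (β ^ p ^ M).ne_zero (by rw [Units.val_pow_eq_pow_val]; exact hb.symm.trans (map_zero _))
  have hpow : p ^ M = p ^ M₀ * p ^ (1 + d) := by rw [hMdef, add_assoc, pow_add]
  have hMc : M - d = M₀ + 1 := by rw [hMdef]; omega
  have hM1 : M₀ ≤ M - 1 := by rw [hMdef]; omega
  -- §2 (v): local `p^{M₀}`-th powers above `v` from `awayKer` (root form at level `M`, B4c, then one level down)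
  have hrootv : ∀ σ : absoluteGaloisGroup K, ∃ β' : AlgebraicClosure K, β' ^ p ^ M = ((b : F') : AlgebraicClosure K) ∧
      ∀ τ : absoluteGaloisGroup K, τ ∈ galFixing K F' → σ * τ * σ⁻¹ ∈ decomp v → τ • β' = β' := by
    intro σ
    obtain ⟨β', hβ', hfix⟩ := exists_root_fixed_of_resOfLe_conjH1_eq_zero hι φ hX hc hU' hεU' hres (decomp v) σ (hloc σ)
    refine ⟨(β' : AlgebraicClosure K), ?_, fun τ hτ hτD ↦ ?_⟩
    · rw [← hβM, ← Units.val_pow_eq_pow_val, hβ', Units.val_pow_eq_pow_val]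
    · rw [← Units.coe_smul, hfix τ hτ hτD]
  have hlocal : ∀ w : v.Extension (𝓞 F'), ∃ y : w.1.adicCompletion F', y ^ p ^ M₀ = algebraMap F' (w.1.adicCompletion F') b := by
    intro w
    obtain ⟨y, hy⟩ := exists_pow_eq_adicCompletion_of_forall_exists_root_fixed F' v (p ^ M) b hrootv w
    exact ⟨y ^ p ^ (1 + d), by rw [← pow_mul, mul_comm, ← hpow, hy]⟩
  -- §2 (away from `v`): `p^{M₀} ∣ ord_{w′}(b′)` at every place `w′ ∤ v` of `F′`
  have hval : ∀ w' : HeightOneSpectrum (𝓞 F'), w'.under (𝓞 K) ≠ v →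
      ((p ^ M₀ : ℕ) : ℤ) ∣ WithZero.log (w'.valuation F' b) := by
    intro w' hw'v
    -- from `p^M ∣ 2 · ord` or `p^M ∣ ord`
    have hweak : ((p ^ M : ℕ) : ℤ) ∣ WithZero.log (w'.valuation F' b) → ((p ^ M₀ : ℕ) : ℤ) ∣ WithZero.log (w'.valuation F' b) :=
      fun h ↦ (Int.natCast_dvd_natCast.mpr (pow_dvd_pow p hM₀M)).trans h
    have hslack : ((p ^ (M - d) : ℕ) : ℤ) ∣ WithZero.log (w'.valuation F' b) → ((p ^ M₀ : ℕ) : ℤ) ∣ WithZero.log (w'.valuation F' b) :=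
      fun h ↦ (Int.natCast_dvd_natCast.mpr (pow_dvd_pow p (by rw [hMc]; exact Nat.le_succ M₀))).trans h
    have htwo : ((p ^ M : ℕ) : ℤ) ∣ 2 * WithZero.log (w'.valuation F' b) → ((p ^ M₀ : ℕ) : ℤ) ∣ WithZero.log (w'.valuation F' b) :=
      fun h ↦ by
        have h1 : ((p ^ (M - 1 + 1) : ℕ) : ℤ) ∣ 2 * WithZero.log (w'.valuation F' b) := by
          rwa [Nat.sub_add_cancel (by rw [hMdef]; omega)]
        exact (Int.natCast_dvd_natCast.mpr (pow_dvd_pow p hM1)).trans (prime_pow_dvd_of_pow_succ_dvd_two_mul hp h1)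
    -- a prime `𝔓` of `\bar ℤ_K` above `w′`, above the place `w := w′ ∩ K`
    obtain ⟨𝔓, h𝔓, h𝔓w⟩ := exists_prime_absIntegers_comap_eq F' w'
    haveI := h𝔓
    have hunder := comap_algebraMap_eq_under_of_comap_eq F' h𝔓w
    have hmem : 𝔓 ∈ (w'.under (𝓞 K)).primesAbove := HeightOneSpectrum.mem_primesAbove_iff.2 ⟨h𝔓, ⟨hunder.symm⟩⟩
    by_cases hwbar : w'.under (𝓞 K) = vbar
    · -- above `v̄`: divisibility given, or the non-split trick
      rcases hbar β (fun u ↦ by rw [← hc u (hU' u.2)]; exact hcβ u) b (by rw [Units.val_pow_eq_pow_val]; exact hb) ⟨w', hwbar⟩ with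
        hdiv | ⟨𝔓', h𝔓'w, s, hsU, hεs, hs𝔓'⟩
      · exact hslack hdiv
      · exact htwo (dvd_two_mul_log_valuation_of_twisted (galFixing K F) ε F' hU' hεU' hker hcc β.ne_zero hres' hb w' 𝔓' h𝔓'w
          hsU (units_val_eq_neg_one_of_ne_one hεs) (hcM s hsU) hs𝔓')
    · rcases hunr (w'.under (𝓞 K)) hw'v hwbar with hunrw | ⟨hIU, hram⟩
      · -- unramified branch: root form, prime form, B4b
        have hrootw : ∀ σ : absoluteGaloisGroup K, ∃ β' : AlgebraicClosure K, β' ^ p ^ M = ((b : F') : AlgebraicClosure K) ∧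
            ∀ τ : absoluteGaloisGroup K, τ ∈ galFixing K F' →
              σ * τ * σ⁻¹ ∈ GreenbergSelmer.inertia (w'.under (𝓞 K)) → τ • β' = β' := by
          intro σ
          have h0 := (mem_unramifiedKer_iff_resOfLe_inf_inertia_eq_zero (H := galFixing K F) (w := w'.under (𝓞 K)) _).1 (hunrw σ)
          obtain ⟨β', hβ', hfix⟩ := exists_root_fixed_of_resOfLe_conjH1_eq_zero hι φ hX hc hU' hεU' hres
            (GreenbergSelmer.inertia (w'.under (𝓞 K))) σ h0
          refine ⟨(β' : AlgebraicClosure K), ?_, fun τ hτ hτI ↦ ?_⟩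
          · rw [← hβM, ← Units.val_pow_eq_pow_val, hβ', Units.val_pow_eq_pow_val]
          · rw [← Units.coe_smul, hfix τ hτ hτI]
        obtain ⟨β', hβ', hτ⟩ := forall_primesAbove_exists_root_fixed_of_forall_conj (galFixing K F') (w'.under (𝓞 K)) hrootw 𝔓 hmem
        exact hweak (by
          exact_mod_cast dvd_log_valuation_of_galFixing_inter_inertia_fixes_root F' (pow_pos hp.pos M) hβ' w' 𝔓 h𝔓w hτ)
      · -- ramified branch: the non-split valuation trick
        obtain ⟨s, hsU, hεs, hsI⟩ := exists_mem_inertia_sign_eq_neg_one (galFixing K F) ε hIU hram hmem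
        exact htwo (dvd_two_mul_log_valuation_of_twisted_of_mem_inertia (galFixing K F) ε F' hU' hεU' hker hcc β.ne_zero hres' hb
          w' 𝔓 h𝔓w hsU hεs (hcM s hsU) hsI)
  -- R1 over `F′` at level `k + e`
  obtain ⟨y₀, hy₀⟩ := hM₀ b hb0 hval hlocal
  have hy₀0 : y₀ ≠ 0 := by
    intro h0
    rw [h0, zero_pow (pow_ne_zero _ hp.ne_zero)] at hy₀
    exact hb0 hy₀.symm
  have hβy : (β : AlgebraicClosure K) ^ p ^ M = ((y₀ : F') : AlgebraicClosure K) ^ p ^ (k + e) := by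
    rw [hβM, ← hy₀]
    rfl
  -- θ-descent: `c^{p^{M−k}}` is a twisted coboundary of a `p^k`-th root of unity on `U`
  obtain ⟨m, hmk, hcob⟩ := twisted_proNull_of_untwisted F' he hU' hεU' hker hcc (hkeM₀.trans hM₀M) hcM β.ne_zero hres' hy₀0 hβy
  -- the pushed class vanishes
  exact resH1Hom_id_eq_zero_of_twistedCoboundary ι₀ hι₀inj hι₀ t ht htι φ hc (hι₀surj m hmk) hcob

end Summit.BirchSwinnertonDyer.BirchSwinnertonDyer.Theorems.PrintCf2.KummerUDict

end
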